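import Literature.NumberTheory.EllipticCurves.ZpExtensionGaloisTwistRestrict
import Literature.NumberTheory.EllipticCurves.IwasawaTowerTorsionProofs
import Literature.NumberTheory.EllipticCurves.SubgroupSelmerCocycleCriteriaProofs
import HarnessLib

/-!
# The twisted restriction `H¹(Γ_K, E[p^J](χ_u)) → H¹(K_∞, E[p^∞])` is INJECTIVE when `E(K)[p] = 0`

Route `ThetaPartnerAtTwo` (TP2), crux K4 `SignedControlAtTwo` (stmt-BirchSwinnertonDyer-20309), line `eulerchar` v9; width
seat `bsd-wall-tp2-p3-w2` g4 (`--supports stmt-BirchSwinnertonDyer-20309`, helper). TWIST ROAD, file T2 (sequel of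
`…RelaxedTwistCount`): the map `W.twistedTorsionToH1 p κ J u hu : H¹(Γ_K, E[p^J](χ_u)) → H¹(K_∞, E[p^∞])`
(restriction to `G_{K_∞} = ker κ`, where the twist is invisible, then `E[p^J] ↪ E[p^∞]`; Greenberg LNM 1716 p. 124,
`H¹(F_Σ/F, A_s) → H¹(F_Σ/F_∞, A_s) = H¹(F_Σ/F_∞, E[p^∞])`) through which the relaxed twisted classes of T1 are fed into
`H = H¹(K_Σ/K_∞, E[p^∞])`. Its kernel is controlled by `E(K_∞)[p^∞]`, which VANISHES as soon as `E(K)[p] = 0` (tree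
theorem `fixedPoints_kerSubgroup_geomPrimaryTorsion_eq_bot`: the fixed-point principle for the pro-`p` group `Γ`), so
on this road no Lemma-3.1 kernel bookkeeping is needed:

* `galoisTwistRestrict_injective_of_fixedPoints` — the twisted restriction `H¹(Γ_K, E[p^J](χ_u)) → H¹(K_∞, E[p^J])`
  (`ZpExtension.galoisTwistRestrict`) is injective when `E[p^J]^{G_{K_∞}} = 0`: inflation–restriction on explicit
  twisted crossed homomorphisms (`galoisTwist_contOneCocycles_apply_mul`) — if `ξ|_{G_{K_∞}} = ∂m` then
  `σ ↦ ξσ − (χ_u(σ)σm − m)` is `G_{K_∞}`-invariant (compare `ξ(hσ)` and `ξ(σ·σ⁻¹hσ)`), hence `0`;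
* `resH1Hom_id_inclusion_injective_of_fixedPoints` — `(E[p^J] ↪ E[p^∞])_*` is injective on `H¹(K_∞, ·)` when
  `E[p^∞]^{G_{K_∞}} = 0` (`φ = ∂a`, `p^J a` fixed ⇒ `a ∈ E[p^J]`; the tree's `torsionPowToPrimaryH1_injective` at `K_∞`);
* `twistedTorsionToH1_injective` — **`E(K)[p] = 0 ⟹ twistedTorsionToH1` injective.**

HONEST FRAMING: THEOREMS ONLY (no definition, no named fact, no `sorry`); pure Galois-cohomological plumbing; closes
nothing; BSD is not proved by any of this.

References: [cite: GreenbergLNM1716, §1 p. 62, §4 pp. 107, 124] [cite: SerreGaloisCohomology1997, I §2.6, I §5.8]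
[cite: WZhang2014, p. 248].
-/

set_option linter.dupNamespace false

noncomputable section
open scoped Classical
open CategoryTheory Field
open Literature.NumberTheory.EllipticCurves Literature.NumberTheory.GaloisRepresentations
open scoped ContRepresentation
namespace Summit.BirchSwinnertonDyer.BirchSwinnertonDyer.Theorems.SignedEC.TwistRestrict

variable {K : Type} [Field K] [NumberField K] (W : WeierstrassCurve K) [W.IsElliptic] (p : ℕ) [Fact p.Prime]
  (κ : ZpExtension K p) (J : ℕ) (u : ℤ) (hu : (p : ℤ) ∣ u - 1)

/-! ## §1 The restriction `H¹(Γ_K, E[p^J](χ_u)) → H¹(K_∞, E[p^J])` is injective when `E[p^J]^{G_{K_∞}} = 0` -/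

omit [NumberField K] [W.IsElliptic] in
/-- **Injectivity of the twisted restriction to `K_∞`** (inflation–restriction with
`H¹(Γ, E[p^J](χ_u)^{G_{K_∞}}) = H¹(Γ, 0) = 0`, on cocycles): if a twisted crossed homomorphism `ξ` is the
coboundary `∂m` on `G_{K_∞} = ker κ`, then `σ ↦ ξ σ − (χ_u(σ)σm − m)` takes values in `E[p^J]^{ker κ}` (compare
`ξ(hσ)` and `ξ(σh')`, `hσ = σh'`), hence vanishes, so `ξ = ∂_χ m` is a coboundary of `E[p^J](χ_u)`.
[cite: GreenbergLNM1716, §4 pp. 107, 124] [cite: SerreGaloisCohomology1997, I §2.6] -/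
theorem galoisTwistRestrict_injective_of_fixedPoints
    (hfix : ∀ m : W.geomTorsion ((p ^ J : ℕ) : ℤ), (∀ h : κ.kerSubgroup, (h : absoluteGaloisGroup K) • m = m) → m = 0) :
    Function.Injective (κ.galoisTwistRestrict (W.torsionGaloisModule ((p ^ J : ℕ) : ℤ)) (fun _ _ ↦ rfl) J
      (W.pow_nsmul_geomTorsion_pow p J) u hu) := by
  set ρ := W.torsionGaloisModule ((p ^ J : ℕ) : ℤ) with hρ
  refine (injective_iff_map_eq_zero _).mpr fun x hx ↦ ?_
  obtain ⟨ξ, rfl⟩ := oneCocycleClass_surjective _ x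
  rw [ZpExtension.galoisTwistRestrict_oneCocycleClass, oneCocycleClass_eq_zero_iff] at hx
  obtain ⟨m, hm⟩ := hx
  -- `hm h : ξ h = h • m - m` on `ker κ`
  have hm' : ∀ h : κ.kerSubgroup, ξ.1 (h : absoluteGaloisGroup K) = (h : absoluteGaloisGroup K) • m - m := fun h ↦ hm h
  -- the twisted cocycle identity
  have hcoc := ZpExtension.galoisTwist_contOneCocycles_apply_mul κ ρ (fun _ _ ↦ rfl) J
    (W.pow_nsmul_geomTorsion_pow p J) u hu ξ
  -- the defect `d σ = ξ σ − (u^{e σ} • σ • m − m)` is fixed by `ker κ`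
  have hd : ∀ (σ : absoluteGaloisGroup K) (h : κ.kerSubgroup),
      (h : absoluteGaloisGroup K) • (ξ.1 σ - ((u ^ κ.twistExponent J σ) • σ • m - m)) =
        ξ.1 σ - ((u ^ κ.twistExponent J σ) • σ • m - m) := by
    intro σ h
    have hh' : σ⁻¹ * (h : absoluteGaloisGroup K) * σ ∈ κ.kerSubgroup :=
      Subgroup.Normal.conj_mem' inferInstance _ h.2 σ
    have hprod : σ * (σ⁻¹ * (h : absoluteGaloisGroup K) * σ) = (h : absoluteGaloisGroup K) * σ := by group
    have e1 : ξ.1 ((h : absoluteGaloisGroup K) * σ) =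
        ((h : absoluteGaloisGroup K) • m - m) + (h : absoluteGaloisGroup K) • ξ.1 σ := by
      rw [hcoc, κ.twistExponent_eq_zero_of_mem_kerSubgroup h.2, pow_zero, one_smul, hm' h]
    have e2 : ξ.1 ((h : absoluteGaloisGroup K) * σ) =
        ξ.1 σ + (u ^ κ.twistExponent J σ) • ((h : absoluteGaloisGroup K) • σ • m - σ • m) := by
      rw [← hprod, hcoc, hm' ⟨_, hh'⟩, smul_sub, ← mul_smul σ, hprod, mul_smul]
    have key : (h : absoluteGaloisGroup K) • ξ.1 σ =
        ξ.1 σ + (u ^ κ.twistExponent J σ) • ((h : absoluteGaloisGroup K) • σ • m - σ • m) -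
          ((h : absoluteGaloisGroup K) • m - m) :=
      eq_sub_of_add_eq' (e1.symm.trans e2)
    rw [smul_sub, smul_sub, smul_comm (h : absoluteGaloisGroup K) (u ^ κ.twistExponent J σ) (σ • m), key,
      smul_sub]
    abel
  -- hence the defect vanishes and `ξ = ∂_χ m`
  have hd0 : ∀ σ : absoluteGaloisGroup K, ξ.1 σ = (u ^ κ.twistExponent J σ) • σ • m - m := fun σ ↦
    sub_eq_zero.mp (hfix _ (hd σ))
  refine (oneCocycleClass_eq_zero_iff _ ξ).mpr ⟨m, fun σ ↦ ?_⟩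
  rw [hd0 σ]
  rfl

/-! ## §2 `H¹(K_∞, E[p^J]) → H¹(K_∞, E[p^∞])` is injective when `E(K_∞)[p^∞] = 0` -/

omit [NumberField K] [W.IsElliptic] in
/-- **Injectivity of `(E[p^J] ↪ E[p^∞])_*` on `H¹(K_∞, ·)` when `E[p^∞]^{G_{K_∞}} = 0`**: a cocycle with values
in `E[p^J]` that is the coboundary of `a ∈ E[p^∞]` over `G_{K_∞}` has `p^J a` fixed by `G_{K_∞}`, hence `0`, so
`a ∈ E[p^J]` (the tree's `torsionPowToPrimaryH1_injective` with `Γ_K` replaced by `G_{K_∞} = ker κ`).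
[cite: GreenbergLNM1716, §2 (pp. 62–63)] [cite: WZhang2014, p. 248] -/
theorem resH1Hom_id_inclusion_injective_of_fixedPoints
    (hfix : ∀ a : W.geomPrimaryTorsion p, (∀ h : κ.kerSubgroup, (h : absoluteGaloisGroup K) • a = a) → a = 0)
    (hc : ∀ (x : κ.kerSubgroup) (m : W.geomTorsion ((p ^ J : ℕ) : ℤ)),
      AddSubgroup.inclusion (Literature.Barriers.BirchSwinnertonDyer.geomTorsion_pow_le_geomPrimaryTorsion W p J)
        (ContinuousMonoidHom.id κ.kerSubgroup x • m) =
      x • AddSubgroup.inclusion (Literature.Barriers.BirchSwinnertonDyer.geomTorsion_pow_le_geomPrimaryTorsion W p J) m) :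
    Function.Injective (resH1Hom (ContinuousMonoidHom.id κ.kerSubgroup)
      (AddSubgroup.inclusion
        (Literature.Barriers.BirchSwinnertonDyer.geomTorsion_pow_le_geomPrimaryTorsion W p J)) hc) := by
  refine (injective_iff_map_eq_zero _).mpr fun y hy ↦ ?_
  obtain ⟨φ, rfl⟩ := oneCocycleClass_surjective _ y
  rw [CocycleCriteria.resH1Hom_oneCocycleClass_eq_zero_iff] at hy
  obtain ⟨a, ha⟩ := hy
  have ha' : ∀ h : κ.kerSubgroup,
      ((φ.1 h : W.geomTorsion ((p ^ J : ℕ) : ℤ)) : W.geomPoints) =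
        (h : absoluteGaloisGroup K) • (a : W.geomPoints) - a := by
    intro h
    have h1 := ha h
    change AddSubgroup.inclusion
      (Literature.Barriers.BirchSwinnertonDyer.geomTorsion_pow_le_geomPrimaryTorsion W p J) (φ.1 h) = h • a - a at h1
    have h' := congrArg (fun b : W.geomPrimaryTorsion p ↦ (b : W.geomPoints)) h1
    simpa only [AddSubgroup.coe_inclusion, AddSubgroupClass.coe_sub, Subgroup.smul_def,
      primaryComponent.coe_smul] using h'
  -- `p^J a` is fixed by `ker κ`, hence zero
  have hpJa : p ^ J • (a : W.geomPoints) = 0 := by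
    have hfixed : ∀ h : κ.kerSubgroup, (h : absoluteGaloisGroup K) • (p ^ J • a) = p ^ J • a := by
      intro h
      apply Subtype.ext
      rw [primaryComponent.coe_smul, AddSubmonoidClass.coe_nsmul, smul_comm, ← sub_eq_zero,
        ← smul_sub, ← ha' h, ← AddSubmonoidClass.coe_nsmul, AddSubgroup.torsionBy.nsmul,
        ZeroMemClass.coe_zero]
    have h0 := hfix _ hfixed
    have h1 := congrArg (fun b : W.geomPrimaryTorsion p ↦ (b : W.geomPoints)) h0
    simpa only [AddSubmonoidClass.coe_nsmul, ZeroMemClass.coe_zero] using h1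
  set a' : W.geomTorsion ((p ^ J : ℕ) : ℤ) := ⟨(a : W.geomPoints), AddSubgroup.torsionBy.nsmul_iff.mpr hpJa⟩
    with ha'def
  refine (oneCocycleClass_eq_zero_iff _ φ).mpr ⟨a', fun h ↦ Subtype.ext ?_⟩
  change ((φ.1 h : W.geomTorsion ((p ^ J : ℕ) : ℤ)) : W.geomPoints) =
    (((h • a' - a' : W.geomTorsion ((p ^ J : ℕ) : ℤ))) : W.geomPoints)
  rw [AddSubgroupClass.coe_sub, Subgroup.smul_def, AddSubgroup.torsionBy.coe_smul, ha']

/-! ## §3 `twistedTorsionToH1` is injective when `E(K)[p] = 0` -/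

/-- **`twistedTorsionToH1 : H¹(Γ_K, E[p^J](χ_u)) → H¹(K_∞, E[p^∞])` is INJECTIVE when `E(K)[p] = 0`**: then
`E(K_∞)[p^∞] = E[p^∞]^{G_{K_∞}} = 0` (tree `fixedPoints_kerSubgroup_geomPrimaryTorsion_eq_bot`: fixed-point
principle for the pro-`p` group `Γ`), so both the twisted restriction (§1) and the change of coefficients (§2)
are injective. No Lemma-3.1 kernel bookkeeping is needed on this road. [cite: GreenbergLNM1716, §1 p. 62, §4 pp. 107, 124] -/
theorem twistedTorsionToH1_injective (hK : ∀ P : W.toAffine.Point, p • P = 0 → P = 0) :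
    Function.Injective (W.twistedTorsionToH1 p κ J u hu) := by
  have hbot := W.fixedPoints_kerSubgroup_geomPrimaryTorsion_eq_bot (κ := κ) hK
  have hfix : ∀ a : W.geomPrimaryTorsion p,
      (∀ h : κ.kerSubgroup, (h : absoluteGaloisGroup K) • a = a) → a = 0 := by
    intro a ha
    have hmem : a ∈ FixedPoints.addSubgroup κ.kerSubgroup (W.geomPrimaryTorsion p) := by
      rw [FixedPoints.mem_addSubgroup]
      intro h
      rw [Subgroup.smul_def]
      exact ha h
    rw [hbot] at hmem
    exact (AddSubgroup.mem_bot).mp hmem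
  have hfixJ : ∀ m : W.geomTorsion ((p ^ J : ℕ) : ℤ),
      (∀ h : κ.kerSubgroup, (h : absoluteGaloisGroup K) • m = m) → m = 0 := by
    intro m hm
    have h0 := hfix (AddSubgroup.inclusion
      (Literature.Barriers.BirchSwinnertonDyer.geomTorsion_pow_le_geomPrimaryTorsion W p J) m) (fun h ↦ by
        apply Subtype.ext
        rw [primaryComponent.coe_smul, AddSubgroup.coe_inclusion, ← AddSubgroup.torsionBy.coe_smul, hm h])
    have h1 := congrArg (fun b : W.geomPrimaryTorsion p ↦ (b : W.geomPoints)) h0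
    simp only [AddSubgroup.coe_inclusion, ZeroMemClass.coe_zero] at h1
    exact Subtype.ext h1
  intro x y hxy
  have hxy' := hxy
  rw [WeierstrassCurve.twistedTorsionToH1, ZpExtension.galoisTwistRestrictTo_apply,
    ZpExtension.galoisTwistRestrictTo_apply] at hxy'
  exact galoisTwistRestrict_injective_of_fixedPoints W p κ J u hu hfixJ
    (resH1Hom_id_inclusion_injective_of_fixedPoints W p κ J hfix _ hxy')

end Summit.BirchSwinnertonDyer.BirchSwinnertonDyer.Theorems.SignedEC.TwistRestrict

end
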